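import Mathlib
import Summits.Parity.BatemanHorn.Theorems.IsogenyRedeiTypeIMainTermRieszInput
import HarnessLib

/-!
# Type-I main term for Bateman–Horn (stmt-Parity-0873), input A1 (part 2):
# log-Riesz means of `μ(n) ρ_f(n)/n` through `H(s)/ζ_K(s)`

For `f ∈ ℤ[X]` irreducible of positive degree with root counts `ρ_f(n) = #{ν mod n : f(ν) ≡ 0}`
we prove the de la Vallée-Poussin–quality evaluation of the logarithmic Riesz means of the
Möbius-twisted root density `μ(n) ρ_f(n)/n` (`= μ(n) · rootDensity f n`):

* `abs_logRieszMean_moebius_rootDensity_sub_le` — there are `c₀ ∈ ℝ`, `c > 0`, `C` with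
  `|∑_{n ≤ x} μ(n) (ρ_f(n)/n) log(x/n) − c₀| ≤ C exp(−c √log x)` for all `x ≥ 1`.

Method (Heath-Brown, Acta Math. 186 (2001), pp. 62–63, the singular-series sum `Σ₁`): with
`K = ℚ[X]/(g₁)`, `g₁` the monic integral normalisation of `f`, the Dirichlet series
`A(s) = ∑ μ(n)ρ_f(n) n^{-s}` satisfies `A(s) ζ_K(s) = H(s)` where `H = a_f ⋆ c_K` is multiplicative
with `H(p) = c_K(p) − ρ_f(p) = 0` for all primes `p ∤ E` (Dedekind–Kummer,
`DegreeOnePrimes.exists_card_absNorm_eq_prime_eq_rootCount`, transported to non-monic `f` by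
`polyRootCountMod_integralNormalization`), and `‖H(p^e)‖ ≤ (B+1)(e+1)^{[K:ℚ]}`; hence
`∑ ‖H(n)‖ n^{-3/4} < ∞` with an explicit Euler-product bound (`numer_local_factor`,
`numer_LSeriesSummable_three_quarters`), and the tree's
`Literature.NumberTheory.LFunctions.NumberField.logRieszMean_LSeries_div_dedekindZeta_bound`
(Perron's formula for log-Riesz means and Landau's zero-free region for `ζ_K`) applies.

Also recorded here (used by the de-smoothing file): the divisor-type bound
`B^{ω(n)} ≤ B^N n^δ` (`pow_card_primeFactors_le`), `ρ_f(n) ≤ B^{ω(n)}` for square-free `n`, and a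
uniform bound `ρ_f(p) ≤ B` (`exists_rootCount_prime_le`). Everything here is proved.
-/

noncomputable section

open Filter Finset Polynomial ArithmeticFunction Complex
open scoped ArithmeticFunction.Moebius ArithmeticFunction.omega Topology

namespace Summit.Parity.BatemanHorn.Theorems.TypeIMainTerm

open Literature.NumberTheory.Sieve Literature.NumberTheory.LFunctions

variable {K : Type*} [Field K] [NumberField K]

/-! ### Local bounds for the numerator `H` -/

/-- `‖H(p^e)‖ ≤ (B + 1)(e + 1)^{[K:ℚ]}` for `e ≥ 1`, if `ρ_f(p) ≤ B`. -/
theorem norm_numer_prime_pow_le (f : ℤ[X]) {B : ℝ} (hB0 : 0 ≤ B)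
    (hB : ∀ p : ℕ, p.Prime → (polyRootCountMod ![f] p : ℝ) ≤ B) {p : ℕ} (hp : p.Prime) {e : ℕ}
    (he : 1 ≤ e) :
    ‖numer K f (p ^ e)‖ ≤ (B + 1) * ((e : ℝ) + 1) ^ Module.finrank ℚ K := by
  set d := Module.finrank ℚ K
  rw [numer_prime_pow K f hp he]
  have h1 : (idealNormCount K (p ^ e) : ℝ) ≤ ((e : ℝ) + 1) ^ d := idealNormCount_prime_pow_le K p e hp
  have h2 : (idealNormCount K (p ^ (e - 1)) : ℝ) ≤ ((e : ℝ) + 1) ^ d := by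
    refine (idealNormCount_prime_pow_le K p (e - 1) hp).trans ?_
    gcongr
    exact_mod_cast Nat.sub_le e 1
  have h3 := hB p hp
  have hpow : (0 : ℝ) ≤ ((e : ℝ) + 1) ^ d := by positivity
  calc ‖(idealNormCount K (p ^ e) : ℂ) - (polyRootCountMod ![f] p : ℂ) * idealNormCount K (p ^ (e - 1))‖
      ≤ ‖(idealNormCount K (p ^ e) : ℂ)‖ + ‖(polyRootCountMod ![f] p : ℂ) * idealNormCount K (p ^ (e - 1))‖ :=
        norm_sub_le _ _
    _ = (idealNormCount K (p ^ e) : ℝ) + (polyRootCountMod ![f] p : ℝ) * idealNormCount K (p ^ (e - 1)) := by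
        rw [norm_mul, Complex.norm_natCast, Complex.norm_natCast, Complex.norm_natCast]
    _ ≤ ((e : ℝ) + 1) ^ d + B * ((e : ℝ) + 1) ^ d :=
        add_le_add h1 (mul_le_mul h3 h2 (Nat.cast_nonneg _) hB0)
    _ = (B + 1) * ((e : ℝ) + 1) ^ d := by ring

/-- `‖H(p)‖ ≤ 2^{[K:ℚ]} + B`. -/
theorem norm_numer_prime_le (f : ℤ[X]) {B : ℝ}
    (hB : ∀ p : ℕ, p.Prime → (polyRootCountMod ![f] p : ℝ) ≤ B) {p : ℕ} (hp : p.Prime) :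
    ‖numer K f p‖ ≤ (2 : ℝ) ^ Module.finrank ℚ K + B := by
  have h := numer_prime_pow K f hp (le_refl 1)
  rw [pow_one, Nat.sub_self, pow_zero, idealNormCount_one, Nat.cast_one, mul_one] at h
  rw [h]
  calc ‖(idealNormCount K p : ℂ) - (polyRootCountMod ![f] p : ℂ)‖
      ≤ ‖(idealNormCount K p : ℂ)‖ + ‖(polyRootCountMod ![f] p : ℂ)‖ := norm_sub_le _ _
    _ ≤ (2 : ℝ) ^ Module.finrank ℚ K + B := by
        rw [Complex.norm_natCast, Complex.norm_natCast]
        exact add_le_add (idealNormCount_prime_le K hp) (hB p hp)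

/-- `H(p) = 0` at the primes where Dedekind–Kummer applies (`c_K(p) = ρ_f(p)`). -/
theorem numer_prime_eq_zero (f : ℤ[X]) {p : ℕ} (hp : p.Prime)
    (hgood : idealNormCount K p = polyRootCountMod ![f] p) : numer K f p = 0 := by
  have h := numer_prime_pow K f hp (le_refl 1)
  rw [pow_one, Nat.sub_self, pow_zero, idealNormCount_one, Nat.cast_one, mul_one, hgood,
    sub_self] at h
  exact h

/-- **The local factors of `∑ ‖H(n)‖ n^{-3/4}`.** There is `M ≥ 0` (depending on `[K:ℚ]` only)
such that for every prime `p`, with `r = p^{-3/4}`, the series `∑_ν ‖H(p^ν)‖ r^ν` converges and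
is at most `1 + ‖H(p)‖ r + (B + 1) M p^{-3/2}`. -/
theorem numer_local_factor (f : ℤ[X]) {B : ℝ} (hB0 : 0 ≤ B)
    (hB : ∀ p : ℕ, p.Prime → (polyRootCountMod ![f] p : ℝ) ≤ B) :
    ∃ M : ℝ, 0 ≤ M ∧ ∀ p : ℕ, p.Prime →
      Summable (fun ν : ℕ => ‖numer K f (p ^ ν)‖ * ((p : ℝ) ^ (-(3 / 4 : ℝ))) ^ ν) ∧
        ∑' ν : ℕ, ‖numer K f (p ^ ν)‖ * ((p : ℝ) ^ (-(3 / 4 : ℝ))) ^ ν ≤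
          1 + (‖numer K f p‖ * (p : ℝ) ^ (-(3 / 4 : ℝ)) +
            (B + 1) * M * (p : ℝ) ^ (-(3 / 2 : ℝ))) := by
  set d := Module.finrank ℚ K
  set r₀ : ℝ := (2 : ℝ) ^ (-(3 / 4 : ℝ)) with hr₀
  have hr₀0 : 0 < r₀ := Real.rpow_pos_of_pos two_pos _
  have hr₀1 : r₀ < 1 := Real.rpow_lt_one_of_one_lt_of_neg one_lt_two (by norm_num)
  have hM := Literature.Analysis.ODE.summable_succ_pow_mul_geometric d hr₀0.le hr₀1
  -- `M = ∑_j (j+3)^d r₀^j ≤ 3^d ∑_j (j+1)^d r₀^j`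
  set M : ℝ := ∑' j : ℕ, ((j : ℝ) + 3) ^ d * r₀ ^ j with hMdef
  have hmaj : ∀ j : ℕ, ((j : ℝ) + 3) ^ d * r₀ ^ j ≤ (3 : ℝ) ^ d * (((j : ℝ) + 1) ^ d * r₀ ^ j) := by
    intro j
    rw [← mul_assoc, ← mul_pow]
    gcongr
    linarith
  have hMs : Summable (fun j : ℕ => ((j : ℝ) + 3) ^ d * r₀ ^ j) :=
    Summable.of_nonneg_of_le (fun j => by positivity) hmaj (hM.mul_left _)
  have hM0 : 0 ≤ M := tsum_nonneg fun j => by positivity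
  refine ⟨M, hM0, fun p hp => ?_⟩
  have hp2 : (2 : ℝ) ≤ p := by exact_mod_cast hp.two_le
  have hp0 : (0 : ℝ) < p := by linarith
  set r : ℝ := (p : ℝ) ^ (-(3 / 4 : ℝ)) with hr
  have hrpos : 0 < r := Real.rpow_pos_of_pos hp0 _
  have hrr₀ : r ≤ r₀ := Real.rpow_le_rpow_of_nonpos two_pos hp2 (by norm_num)
  have hr1 : r < 1 := lt_of_le_of_lt hrr₀ hr₀1
  have hr2 : r ^ 2 = (p : ℝ) ^ (-(3 / 2 : ℝ)) := by
    rw [hr, ← Real.rpow_natCast, ← Real.rpow_mul hp0.le]; norm_num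
  set t : ℕ → ℝ := fun ν => ‖numer K f (p ^ ν)‖ * r ^ ν with ht
  have ht0 : ∀ ν, 0 ≤ t ν := fun ν => by positivity
  have htle : ∀ ν : ℕ, 1 ≤ ν → t ν ≤ (B + 1) * (((ν : ℝ) + 1) ^ d * r ^ ν) := by
    intro ν hν
    simp only [ht]
    rw [← mul_assoc]
    exact mul_le_mul_of_nonneg_right (norm_numer_prime_pow_le f hB0 hB hp hν) (pow_nonneg hrpos.le _)
  -- summability (compare the shifted series with `(B+1) 2^d (ν+1)^d r^ν`)
  have hshift : Summable (fun ν : ℕ => t (ν + 1)) := by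
    have hmaj2 : ∀ ν : ℕ, t (ν + 1) ≤ (B + 1) * (2 : ℝ) ^ d * (((ν : ℝ) + 1) ^ d * r ^ ν) := by
      intro ν
      refine (htle (ν + 1) (by omega)).trans ?_
      have h1 : (((ν + 1 : ℕ) : ℝ) + 1) ^ d ≤ (2 : ℝ) ^ d * ((ν : ℝ) + 1) ^ d := by
        rw [← mul_pow]; gcongr; push_cast; linarith
      have h2 : r ^ (ν + 1) ≤ r ^ ν := pow_le_pow_of_le_one hrpos.le hr1.le (by omega)
      calc (B + 1) * ((((ν + 1 : ℕ) : ℝ) + 1) ^ d * r ^ (ν + 1))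
          ≤ (B + 1) * ((2 : ℝ) ^ d * ((ν : ℝ) + 1) ^ d * r ^ ν) := by
            gcongr
        _ = (B + 1) * (2 : ℝ) ^ d * (((ν : ℝ) + 1) ^ d * r ^ ν) := by ring
    exact Summable.of_nonneg_of_le (fun ν => ht0 _) hmaj2
      ((Literature.Analysis.ODE.summable_succ_pow_mul_geometric d hrpos.le hr1).mul_left _)
  have hsum : Summable t := (summable_nat_add_iff 1).mp hshift
  refine ⟨hsum, ?_⟩
  -- the value: `t 0 + t 1 + ∑_{ν ≥ 2} t ν`
  have hshift2 : Summable (fun ν : ℕ => t (ν + 2)) := (summable_nat_add_iff 2).mpr hsum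
  rw [hsum.tsum_eq_zero_add, hshift.tsum_eq_zero_add]
  have ht00 : t 0 = 1 := by simp [ht, (isMultiplicative_numer K f).map_one]
  have ht1 : t 1 = ‖numer K f p‖ * r := by simp [ht]
  have htail : ∑' ν : ℕ, t (ν + 1 + 1) ≤ (B + 1) * M * (p : ℝ) ^ (-(3 / 2 : ℝ)) := by
    have hmaj3 : ∀ ν : ℕ, t (ν + 1 + 1) ≤ (B + 1) * r ^ 2 * (((ν : ℝ) + 3) ^ d * r₀ ^ ν) := by
      intro ν
      refine (htle (ν + 1 + 1) (by omega)).trans ?_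
      have h1 : (((ν + 1 + 1 : ℕ) : ℝ) + 1) ^ d = ((ν : ℝ) + 3) ^ d := by push_cast; ring
      have h2 : r ^ (ν + 1 + 1) ≤ r ^ 2 * r₀ ^ ν := by
        rw [show ν + 1 + 1 = 2 + ν by omega, pow_add]
        exact mul_le_mul_of_nonneg_left (pow_le_pow_left₀ hrpos.le hrr₀ ν) (by positivity)
      rw [h1]
      calc (B + 1) * (((ν : ℝ) + 3) ^ d * r ^ (ν + 1 + 1))
          ≤ (B + 1) * (((ν : ℝ) + 3) ^ d * (r ^ 2 * r₀ ^ ν)) := by gcongr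
        _ = (B + 1) * r ^ 2 * (((ν : ℝ) + 3) ^ d * r₀ ^ ν) := by ring
    calc ∑' ν : ℕ, t (ν + 1 + 1) ≤ ∑' ν : ℕ, (B + 1) * r ^ 2 * (((ν : ℝ) + 3) ^ d * r₀ ^ ν) :=
          Summable.tsum_le_tsum hmaj3 hshift2 (hMs.mul_left _)
      _ = (B + 1) * M * (p : ℝ) ^ (-(3 / 2 : ℝ)) := by rw [tsum_mul_left, ← hMdef, hr2]; ring
  rw [ht00, ht1]
  linarith

/-- **Absolute convergence of the numerator on `Re s = 3/4`, uniformly bounded.** If `ρ_f(p) ≤ B`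
for all primes and `c_K(p) = ρ_f(p)` for the primes `p ∤ E` (`E ≠ 0`), then `L(H, 3/4)` converges
absolutely, with an explicit bound for `∑ ‖H(n)‖ n^{-3/4}`. -/
theorem numer_LSeriesSummable_three_quarters (f : ℤ[X]) {B : ℝ} (hB0 : 0 ≤ B)
    (hB : ∀ p : ℕ, p.Prime → (polyRootCountMod ![f] p : ℝ) ≤ B) {E : ℕ} (hE : E ≠ 0)
    (hgood : ∀ p : ℕ, p.Prime → ¬p ∣ E → idealNormCount K p = polyRootCountMod ![f] p) :
    ∃ L : ℝ, LSeriesSummable (fun n => numer K f n) (3 / 4 : ℝ) ∧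
      ∑' n : ℕ, ‖LSeries.term (fun n => numer K f n) (3 / 4 : ℝ) n‖ ≤ Real.exp L := by
  obtain ⟨M, hM0, hloc⟩ := numer_local_factor (K := K) f hB0 hB
  set d := Module.finrank ℚ K
  have hprimes : Summable (fun p : Nat.Primes => ((p : ℕ) : ℝ) ^ (-(3 / 2 : ℝ))) :=
    Nat.Primes.summable_rpow.mpr (by norm_num)
  set S : ℝ := ∑' p : Nat.Primes, ((p : ℕ) : ℝ) ^ (-(3 / 2 : ℝ))
  set L : ℝ := ((2 : ℝ) ^ d + B) * (E.primeFactors.card : ℝ) + (B + 1) * M * S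
  refine ⟨L, LSeriesSummable_and_tsum_norm_le_of_isMultiplicative (isMultiplicative_numer K f) _
    (fun p => ‖numer K f p‖ * (p : ℝ) ^ (-(3 / 4 : ℝ)) + (B + 1) * M * (p : ℝ) ^ (-(3 / 2 : ℝ)))
    L hloc fun X => ?_⟩
  rw [Finset.sum_add_distrib, ← Finset.mul_sum]
  refine add_le_add ?_ (mul_le_mul_of_nonneg_left
    (sum_primesLE_le_tsum_primes (fun p => Real.rpow_nonneg (Nat.cast_nonneg p) _) hprimes X)
    (by positivity))
  -- the first sum only sees the primes dividing `E`
  have hpt : ∀ p ∈ Nat.primesLE X, ‖numer K f p‖ * (p : ℝ) ^ (-(3 / 4 : ℝ)) ≤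
      if p ∣ E then (2 : ℝ) ^ d + B else 0 := by
    intro p hp
    have hp' := Nat.prime_of_mem_primesLE hp
    split_ifs with hpE
    · have h1 : (p : ℝ) ^ (-(3 / 4 : ℝ)) ≤ 1 :=
        Real.rpow_le_one_of_one_le_of_nonpos (by exact_mod_cast hp'.one_lt.le) (by norm_num)
      calc ‖numer K f p‖ * (p : ℝ) ^ (-(3 / 4 : ℝ)) ≤ ‖numer K f p‖ * 1 :=
            mul_le_mul_of_nonneg_left h1 (norm_nonneg _)
        _ ≤ (2 : ℝ) ^ d + B := by rw [mul_one]; exact norm_numer_prime_le f hB hp'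
    · rw [numer_prime_eq_zero f hp' (hgood p hp' hpE), norm_zero, zero_mul]
  refine (Finset.sum_le_sum hpt).trans ?_
  rw [Finset.sum_ite, Finset.sum_const_zero, add_zero, Finset.sum_const, nsmul_eq_mul, mul_comm]
  have hBd : (0 : ℝ) ≤ (2 : ℝ) ^ d + B := by positivity
  refine mul_le_mul_of_nonneg_left ?_ hBd
  exact_mod_cast Finset.card_le_card (fun p hp => by
    rw [Finset.mem_filter, Nat.mem_primesLE] at hp
    exact Nat.mem_primeFactors.mpr ⟨hp.1.2, hp.2, hE⟩)

/-! ### The log-Riesz means of `μ(n) ρ_f(n)/n` -/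

/-- **Log-Riesz means of the Möbius-twisted root density.** For `f ∈ ℤ[X]` irreducible of
positive degree there are `c₀ ∈ ℝ`, `c > 0` and `C` with
`|∑_{n ≤ x} μ(n) (ρ_f(n)/n) log(x/n) − c₀| ≤ C exp(−c √log x)` for all real `x ≥ 1`.
(Heath-Brown, Acta Math. 186 (2001), proof of Lemma 3.9, the sum `Σ₁`, for a general
irreducible `f`: Perron's formula for log-Riesz means of `H(s)/ζ_K(s)`, `K = ℚ[X]/(g₁)`.) -/
theorem abs_logRieszMean_moebius_rootDensity_sub_le {f : ℤ[X]} (hirr : Irreducible f)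
    (hdeg : 1 ≤ f.natDegree) :
    ∃ c₀ c C : ℝ, 0 < c ∧ ∀ x : ℝ, 1 ≤ x →
      |∑ n ∈ Icc 1 ⌊x⌋₊, (μ n : ℝ) * rootDensity f n * Real.log (x / n) - c₀| ≤
        C * Real.exp (-c * Real.sqrt (Real.log x)) := by
  classical
  set g₁ : ℤ[X] := integralNormalization f with hg₁
  have hmon : g₁.Monic := monic_integralNormalization hirr.ne_zero
  have hirr₁ : Irreducible g₁ := irreducible_integralNormalization hirr hdeg
  haveI : Fact (Irreducible (g₁.map (algebraMap ℤ ℚ))) :=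
    ⟨DegreeOnePrimes.irreducible_map_rat hmon hirr₁⟩
  set K := AdjoinRoot (g₁.map (algebraMap ℤ ℚ)) with hK
  obtain ⟨e, he, hcount⟩ := DegreeOnePrimes.exists_card_absNorm_eq_prime_eq_rootCount hmon hirr₁
  -- the exceptional modulus `E = e · |lc f|`
  have hlc : f.leadingCoeff ≠ 0 := leadingCoeff_ne_zero.mpr hirr.ne_zero
  set E : ℕ := e * f.leadingCoeff.natAbs with hE
  have hE0 : E ≠ 0 := Nat.mul_ne_zero he.ne' (Int.natAbs_ne_zero.mpr hlc)
  have hgood : ∀ p : ℕ, p.Prime → ¬p ∣ E → idealNormCount K p = polyRootCountMod ![f] p := by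
    intro p hp hpE
    have hpe : ¬p ∣ e := fun h => hpE (dvd_mul_of_dvd_left h _)
    have hplc : ¬(p : ℤ) ∣ f.leadingCoeff := fun h =>
      hpE (dvd_mul_of_dvd_right (Int.natCast_dvd.mp h) _)
    rw [idealNormCount_def, hcount p hp hpe, ← polyRootCountMod_single, hg₁,
      polyRootCountMod_integralNormalization hdeg hp hplc]
  -- a uniform bound for `ρ_f(p)`
  set d := Module.finrank ℚ K
  set B : ℝ := (2 : ℝ) ^ d + E with hB
  have hB0 : 0 ≤ B := by positivity
  have hBp : ∀ p : ℕ, p.Prime → (polyRootCountMod ![f] p : ℝ) ≤ B := by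
    intro p hp
    by_cases hpE : p ∣ E
    · have h1 : polyRootCountMod ![f] p ≤ E :=
        (polyRootCountMod_le ![f] p).trans (Nat.le_of_dvd (Nat.pos_of_ne_zero hE0) hpE)
      have h2 : (polyRootCountMod ![f] p : ℝ) ≤ E := by exact_mod_cast h1
      have h3 : (0 : ℝ) ≤ (2 : ℝ) ^ d := by positivity
      linarith
    · rw [← hgood p hp hpE]
      have := idealNormCount_prime_le K hp
      have hE' : (0 : ℝ) ≤ E := Nat.cast_nonneg _
      linarith
  obtain ⟨L, hh, hhB⟩ := numer_LSeriesSummable_three_quarters (K := K) f hB0 hBp hE0 hgood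
  obtain ⟨c, hc, C, hC, main⟩ :=
    NumberField.logRieszMean_LSeries_div_dedekindZeta_bound K (σₕ := 3 / 4) (by norm_num)
  have ha : ∀ σ : ℝ, 1 < σ → LSeriesSummable (fun n => moebRho f n) σ := fun σ hσ =>
    LSeriesSummable_moebRho f hB0 hBp hσ
  have hrel : ∀ s : ℂ, 1 < s.re →
      LSeries (fun n => moebRho f n) s * NumberField.dedekindZeta K s =
        LSeries (fun n => numer K f n) s := by
    intro s hs
    have h1 : LSeriesSummable (fun n => moebRho f n) s :=
      (ha s.re hs).of_re_le_re (by simp)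
    rw [← LSeries_normCount K s, numer]
    exact (LSeries_mul' h1 (LSeriesSummable_normCount K hs)).symm
  have key := main (fun n => moebRho f n) (fun n => numer K f n) (Real.exp L) hh hhB ha hrel
  set w : ℂ := LSeries (fun n => numer K f n) 1 / (NumberField.dedekindZeta_residue K : ℂ) with hw
  refine ⟨w.re, c, C * Real.exp L, hc, fun x hx => ?_⟩
  have hxk := key x hx
  have hsum : (∑ n ∈ Icc 1 ⌊x⌋₊, moebRho f n / n * (Real.log (x / n) : ℂ)) =
      ((∑ n ∈ Icc 1 ⌊x⌋₊, (μ n : ℝ) * rootDensity f n * Real.log (x / n) : ℝ) : ℂ) := by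
    push_cast
    refine Finset.sum_congr rfl fun n _ => ?_
    rw [moebRho_apply, rootDensity_apply]
    push_cast
    ring
  rw [hsum] at hxk
  calc |∑ n ∈ Icc 1 ⌊x⌋₊, (μ n : ℝ) * rootDensity f n * Real.log (x / n) - w.re|
      = |(((∑ n ∈ Icc 1 ⌊x⌋₊, (μ n : ℝ) * rootDensity f n * Real.log (x / n) : ℝ) : ℂ) - w).re| := by
        simp
    _ ≤ ‖((∑ n ∈ Icc 1 ⌊x⌋₊, (μ n : ℝ) * rootDensity f n * Real.log (x / n) : ℝ) : ℂ) - w‖ :=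
        Complex.abs_re_le_norm _
    _ ≤ C * Real.exp L * Real.exp (-c * Real.sqrt (Real.log x)) := hxk

/-! ## A2. Sharp Möbius–root-density sums: de-smoothing by Shiu's theorem -/

/-! ### A divisor-type bound: `B^{ω(n)} ≪_δ n^δ` -/

/-- `B^{ω(n)} ≤ B^{N} n^δ` with `N = ⌊B^{1/δ}⌋ + 1` (`B ≥ 1`, `δ > 0`, `n ≥ 1`): the prime factors
`p ≥ N` of `n` each satisfy `B ≤ p^δ` and their product divides `n`. -/
theorem pow_card_primeFactors_le {B : ℝ} (hB : 1 ≤ B) {δ : ℝ} (hδ : 0 < δ) {n : ℕ} (hn : n ≠ 0) :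
    B ^ n.primeFactors.card ≤ B ^ (⌊B ^ (1 / δ)⌋₊ + 1) * (n : ℝ) ^ δ := by
  set N : ℕ := ⌊B ^ (1 / δ)⌋₊ + 1 with hN
  set small := n.primeFactors.filter (fun p => p < N) with hsmall
  set large := n.primeFactors.filter (fun p => ¬p < N) with hlarge
  have hcard : n.primeFactors.card = small.card + large.card := by
    rw [hsmall, hlarge]; exact (Finset.card_filter_add_card_filter_not _).symm
  have hsmallN : small.card ≤ N := by
    calc small.card ≤ (Finset.range N).card :=
          Finset.card_le_card fun p hp => Finset.mem_range.mpr (Finset.mem_filter.mp hp).2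
      _ = N := Finset.card_range N
  have hB0 : 0 ≤ B := by linarith
  -- the large prime factors
  have hNB : ∀ p ∈ large, B ≤ (p : ℝ) ^ δ := by
    intro p hp
    have hpN : N ≤ p := not_lt.mp (Finset.mem_filter.mp hp).2
    have h1 : B ^ (1 / δ) < (p : ℝ) := by
      calc B ^ (1 / δ) < (N : ℝ) := by rw [hN]; push_cast; exact Nat.lt_floor_add_one _
        _ ≤ p := by exact_mod_cast hpN
    have h2 : (B ^ (1 / δ)) ^ δ ≤ (p : ℝ) ^ δ :=
      Real.rpow_le_rpow (Real.rpow_nonneg hB0 _) h1.le hδ.le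
    rwa [← Real.rpow_mul hB0, one_div_mul_cancel hδ.ne', Real.rpow_one] at h2
  have hlargeB : B ^ large.card ≤ (n : ℝ) ^ δ := by
    calc B ^ large.card = ∏ _p ∈ large, B := (Finset.prod_const B).symm
      _ ≤ ∏ p ∈ large, (p : ℝ) ^ δ := Finset.prod_le_prod (fun _ _ => hB0) hNB
      _ = ((∏ p ∈ large, p : ℕ) : ℝ) ^ δ := by
          rw [Nat.cast_prod, Real.finsetProd_rpow _ _ (fun p _ => Nat.cast_nonneg p)]
      _ ≤ (n : ℝ) ^ δ := by
          refine Real.rpow_le_rpow (Nat.cast_nonneg _) ?_ hδ.le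
          have hdvd : (∏ p ∈ large, p) ∣ n :=
            (Finset.prod_dvd_prod_of_subset _ _ _ (Finset.filter_subset _ _)).trans
              (Nat.prod_primeFactors_dvd n)
          exact_mod_cast Nat.le_of_dvd (Nat.pos_of_ne_zero hn) hdvd
  rw [hcard, pow_add]
  exact mul_le_mul (pow_le_pow_right₀ hB hsmallN) hlargeB (pow_nonneg hB0 _) (pow_nonneg hB0 _)

/-- `ρ_f(n) ≤ B^{ω(n)}` for square-free `n` if `ρ_f(p) ≤ B` at all primes. -/
theorem rootCount_le_pow_of_squarefree (f : ℤ[X]) {B : ℝ}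
    (hB : ∀ p : ℕ, p.Prime → (polyRootCountMod ![f] p : ℝ) ≤ B) {n : ℕ} (hn : Squarefree n) :
    (polyRootCountMod ![f] n : ℝ) ≤ B ^ n.primeFactors.card := by
  have hmult := isMultiplicative_rootDensity f
  have hn0 : n ≠ 0 := hn.ne_zero
  -- `ρ_f(n) = ∏_{p ∣ n} ρ_f(p)` for square-free `n` (multiplicativity)
  have key : (polyRootCountMod ![f] n : ℝ) = ∏ p ∈ n.primeFactors, (polyRootCountMod ![f] p : ℝ) := by
    have h := hmult.prod_primeFactors hn
    simp only [rootDensity_apply] at h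
    have hden : ∏ p ∈ n.primeFactors, (p : ℝ) = n := by
      rw [← Nat.cast_prod, Nat.prod_primeFactors_of_squarefree hn]
    rw [Finset.prod_div_distrib, hden] at h
    have hn' : (n : ℝ) ≠ 0 := by exact_mod_cast hn0
    have h2 := (div_left_inj' hn').mp h
    rw [← h2]
  rw [key, ← Finset.prod_const]
  exact Finset.prod_le_prod (fun _ _ => Nat.cast_nonneg _) fun p hp => hB p (Nat.prime_of_mem_primeFactors hp)

/-! ### A uniform bound for `ρ_f(p)` -/

/-- For `f` irreducible of positive degree, `ρ_f(p) ≤ B` for all primes `p`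
(`B = max(deg f, |lc f|)`: Lagrange for `p ∤ lc f`, the trivial bound `ρ_f(p) ≤ p ≤ |lc f|` else). -/
theorem exists_rootCount_prime_le {f : ℤ[X]} (hf0 : f ≠ 0) :
    ∃ B : ℝ, 1 ≤ B ∧ ∀ p : ℕ, p.Prime → (polyRootCountMod ![f] p : ℝ) ≤ B := by
  have hlc : f.leadingCoeff ≠ 0 := leadingCoeff_ne_zero.mpr hf0
  refine ⟨max (f.natDegree : ℝ) (f.leadingCoeff.natAbs : ℝ) + 1,
    le_add_of_nonneg_left (le_max_of_le_left (Nat.cast_nonneg _)), fun p hp => ?_⟩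
  by_cases h : (p : ℤ) ∣ f.leadingCoeff
  · have h1 : p ≤ f.leadingCoeff.natAbs :=
      Nat.le_of_dvd (Int.natAbs_pos.mpr hlc) (Int.natCast_dvd.mp h)
    have h2 : (polyRootCountMod ![f] p : ℝ) ≤ f.leadingCoeff.natAbs := by
      exact_mod_cast (polyRootCountMod_le ![f] p).trans h1
    linarith [le_max_right (f.natDegree : ℝ) (f.leadingCoeff.natAbs : ℝ)]
  · have h2 : (polyRootCountMod ![f] p : ℝ) ≤ f.natDegree := by
      exact_mod_cast polyRootCountMod_single_le_natDegree hp h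
    linarith [le_max_left (f.natDegree : ℝ) (f.leadingCoeff.natAbs : ℝ)]

end Summit.Parity.BatemanHorn.Theorems.TypeIMainTerm

end
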